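import Summits.HodgeConjecture.HodgeConjecture.Theorems.F0P3SpectralPacketTraceIndep   -- ★ (N) FILE 3d′ p842437: `presentationIndep_of_admissible` road (`arch_mul_prod_loc_eq_of_eval_eq`, `loc_ofUnramified_of_isUnramified`, `trPkt_const_smul`, `trPktInf_const_smul`; + ★ 3d `tr`, `trTensor`, `IsTestPresentation`, ★ 2c (TF-1) `UnramTraceOne`)
import HarnessLib

/-!
# (N) DEFS, FILE 3y — THE PACKET TRACE ON PRESENTATIONS WHOSE BAD SET CONTAINS A GIVEN FINITE `S₀`: `SpectralPacketG.trOn Q S₀ νG archTr`, the guarded laws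
# (TF-1)∕S₀ `GlobalPacket.UnramTraceOneOff` and (TF-ind)∕S₀ `SpectralPacketG.PresentationIndepOn`, and (TF-ind)∕S₀ DISCHARGED (Rogawski §13.3 p. 201 l. 1–4; §14.2 p. 233; §4.3 p. 44)

Cell `hodgecm-mathlib` (D-0151), F0∕P3 «U3-mult», crux H413 (`stmt-HodgeConjecture-24833`), route of record `HCCMUnconditional`.  (N) lead pen F0P3a-p01 (g14); REF1 (g23) m02
LIFT CONDITIONS (g1)(g2)(g3) for the TUPLE cut «K9STF ⟸ TUPLE» (desk F0P3-plan D35 (11)–(13)): the (T)∕(P1) slot's trace functional must only read presentations whose bad set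
contains the finite set `S₀ ⊇ M(𝔨.ψ)` of level-MISMATCH places of the pinned comparison `ψ_v : G′_v ≃ G_v` (pin (vi): `ψ_v(K′_v) = K_v` off `S₀`), because the transported
measures `ν_v := (ψ_v)_* νG′_v` have `ν_v(K_v) = νG′_v(ψ_v⁻¹ K_v)`, which is print's `1` [§4.3 p. 44 «`vol(K_v) = 1`»] only where the levels match: ★ FILE 3d's `tr` (product over
the bad set of SOME presentation, bad set `⊇ Π.ramFinset` only) omits the factors `Tr Π_v(1_{K_v}) = ν_v(K_v) ≠ 1` at mismatch places outside the chosen bad set, so it is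
print's `Tr Π(f)` only under the absolute law (TF-1) `UnramTraceOne ν` — print-false at `v ∈ M(𝔨.ψ)` (REF1 (g22) m12∕m16, (g10) m12–m18, ref1 R1-391; F0P3a-p01 (g13) n-vol).
THIS FILE: the same functional with the presentations PINNED TO CONTAIN `S₀` (`trOn`), the two laws RESTRICTED off∕to `S₀`, (TF-ind)∕S₀ PROVED (★ 3d′'s argument verbatim on
`S₀`-presentations), and the consumer form `trOn_eq_of_isTest` over any finite `S′ ⊇ T.S ∪ Π.ramFinset ∪ S₀`.  (TF-1)∕S₀ itself is PROVED from the Haar normalisation, (ℓ4),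
member admissibility and the Gelfand bound in FILE 3y′ (`F0P3SpectralPacketTraceOnLaws`).  Definition lane (four `def`s: three `Prop`-predicates + one functional) +
read-backs; namespaces of ★ FILE 2∕3a; `H′ := splitForm L 3` for the functional (the carrier of `TestG L`); box-before-file; `--supports stmt-HodgeConjecture-24833 --as helper`.
No instance, no notation, no named fact, no `sorry`; no `Classical` instance in any STATEMENT (the choice lives inside the body of `trOn` only).
HONEST LABEL: HC_CM is proved only modulo the printed citations until rung 0 closes; this file proves no printed statement — it re-defines the (T)-slot functional so that its
value IS print's `Tr Π(f)` under print's own normalisation off a finite set, and discharges the bookkeeping law (TF-ind) there.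

CONTENTS.
* §1 (d0) **(TF-1)∕S₀ `GlobalPacket.UnramTraceOneOff Pg S₀ νG`** — «`Tr Π_v(1_{K_v}) = 1` at the unramified places `v ∉ S₀`» (★ 2c `UnramTraceOne` restricted; generic `H′`);
  `UnramTraceOne.off`; `prod_eq_prod_of_subset_of_unramTraceOneOff` (enlarging a finite set `S ⊇ S₀ ∪ Π.ramFinset` by places where `f_v = 1_{K_v}` does not change the product).
* §2 (d1) `SpectralPacketG.IsTestPresentationOn Q S₀ F T := Q.IsTestPresentation F T ∧ S₀ ⊆ T.S`; (d2) **`SpectralPacketG.trOn Q S₀ νG archTr : TestG L → ℂ`** — `trTensor` of SOME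
  `S₀`-presentation if one exists, `0` otherwise; (d3) **(TF-ind)∕S₀ `SpectralPacketG.PresentationIndepOn Q S₀ νG archTr`** — two `S₀`-presentations of one `F` have the same `trTensor`.
* §3 read-backs: `isTestPresentationOn_iff`, `isTestPresentationOn_empty`, **`trOn_empty : Q.trOn ∅ νG archTr = Q.tr νG archTr`** (the ED. 26–28 slot is the case `S₀ = ∅`), `exists_isTestPresentationOn (hT : T.IsTest) (hF : ⇑F = T.eval)` (re-present at `T.S ∪ Π.ramFinset ∪ S₀`, ★ `eval_ofUnramified_of_isUnramified`),
  `trOn_of_not`, `trOn_eq_trTensor (hind)`, `trTensor_eq_prod_of_subset_of_off (h1 : UnramTraceOneOff) (hT : IsTestPresentationOn)`, and the consumer form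
  **`trOn_eq_of_isTest (hind) (h1) (hT) (hF) S′ (T.S ⊆ S′) (Π.ramFinset ⊆ S′) (S₀ ⊆ S′)`** = ★ 3d `tr_eq_of_isTest` for `trOn`, with (TF-1) used only at `v ∉ S₀`.
* §4 **(TF-ind)∕S₀ DISCHARGED — `presentationIndepOn_of_admissible (h1 : UnramTraceOneOff) (hadm) (harch)`** (★ 3d′ `presentationIndep_of_admissible` line for line: common bad set
  `T.S ∪ T′.S ⊇ S₀`, ★ `arch_mul_prod_loc_eq_of_eval_eq`, ★ `mul_prod_eq_of_forall_mul_prod_eq`); `trOn_eq_trTensor_of_admissible`, `trOn_eq_of_isTest_of_admissible`.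

References: [Rogawski1990] §13.3 p. 201 (first display, l. 1–4), §13.7 p. 206, §14.2 p. 233, §14.6 (14.6.1) p. 241, §4.3 p. 44, §5.4 p. 72; [FlathCorvallis1979] Thm. 3;
[BorelJacquet1979] §4.1; [CartierCorvallis1979] §IV.1.
-/

set_option autoImplicit false
-- the mandated namespace repeats `HodgeConjecture.HodgeConjecture`, as in every `Theorems/*.lean` of this sub-problem
set_option linter.dupNamespace false

noncomputable section

open NumberField IsDedekindDomain MeasureTheory
open scoped Matrix MatrixGroups

open Literature.NumberTheory Literature.NumberTheory.Automorphic Literature.NumberTheory.Automorphic.UnitaryGroup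
open Literature.NumberTheory.Rogawski1990 Literature.NumberTheory.GaloisRepresentations
open Literature.RepresentationTheory.BorelWallach2000 Literature.RepresentationTheory.KonnoKonno2007
open Summit.HodgeConjecture.HodgeConjecture.Cruxes.H413.F0P3InnerFormClassificationV6 (TestG splitForm)
open Summit.HodgeConjecture.HodgeConjecture.Cruxes.H413.F0P3LocalPacketKit
open Summit.HodgeConjecture.HodgeConjecture.Cruxes.H413.F0P3ArchPacketKit

/-! ## §1 (TF-1)∕S₀ — the unramified normalisation off a finite set [p. 201 l. 1–4; §4.3 p. 44] (generic `H′`; in FILE 2's namespace) -/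

namespace Summit.HodgeConjecture.HodgeConjecture.Cruxes.H413.F0P3GlobalPacket.GlobalPacket

variable {L : Type} [Field L] [NumberField L] [IsCMField L]
  {H' : Matrix (Fin 3) (Fin 3) L} {𝔩 : ∀ v : HeightOneSpectrum (𝓞 ↥(maximalRealSubfield L)), LocalPacketKit L H' v}

/-- **(TF-1)∕S₀ «`Tr Π_v(1_{K_v}) = 1` AT THE UNRAMIFIED PLACES OF `Π` OUTSIDE `S₀`»** — ★ FILE 2c's (TF-1) `UnramTraceOne` RESTRICTED to `v ∉ S₀`: print's normalisation
`ν_v(K_v) = 1` [§4.3 p. 44; p. 201 l. 1–4] is only asked off a finite set (for the transported measures `(ψ_v)_* νG′_v` of a pinned comparison it holds exactly off the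
level-mismatch set `M(ψ) ⊆ S₀`; FILE 3y′ proves this predicate there from the Haar normalisation, (ℓ4), admissibility and the Gelfand bound). [cite: Rogawski1990, §13.3 p. 201 l. 1–4; §4.3 p. 44]
[cite: CartierCorvallis1979, §IV.1] -/
def UnramTraceOneOff (Pg : GlobalPacket 𝔩) (S₀ : Finset (HeightOneSpectrum (𝓞 ↥(maximalRealSubfield L))))
    [∀ v : HeightOneSpectrum (𝓞 ↥(maximalRealSubfield L)), MeasurableSpace ((cmDatum L 3 H').Local v)]
    (νG : ∀ v : HeightOneSpectrum (𝓞 ↥(maximalRealSubfield L)), Measure ((cmDatum L 3 H').Local v)) : Prop :=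
  ∀ v ∉ S₀, (𝔩 v).unr (Pg.loc v) →
    (𝔩 v).trPkt (νG v) (Pg.loc v) ((cmLocalIntegralLevel L 3 H' v : Set ((cmDatum L 3 H').Local v)).indicator fun _ => 1) = 1

/-- Unfolding of (TF-1)∕S₀. [cite: Rogawski1990, §13.3 p. 201 l. 1–4] -/
theorem unramTraceOneOff_iff (Pg : GlobalPacket 𝔩) (S₀ : Finset (HeightOneSpectrum (𝓞 ↥(maximalRealSubfield L))))
    [∀ v : HeightOneSpectrum (𝓞 ↥(maximalRealSubfield L)), MeasurableSpace ((cmDatum L 3 H').Local v)]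
    (νG : ∀ v : HeightOneSpectrum (𝓞 ↥(maximalRealSubfield L)), Measure ((cmDatum L 3 H').Local v)) :
    Pg.UnramTraceOneOff S₀ νG ↔ ∀ v ∉ S₀, (𝔩 v).unr (Pg.loc v) →
      (𝔩 v).trPkt (νG v) (Pg.loc v) ((cmLocalIntegralLevel L 3 H' v : Set ((cmDatum L 3 H').Local v)).indicator fun _ => 1) = 1 :=
  Iff.rfl

/-- The absolute law (TF-1) implies its restriction off any `S₀`. [cite: Rogawski1990, §13.3 p. 201 l. 1–4] -/
theorem UnramTraceOne.off {Pg : GlobalPacket 𝔩} [∀ v : HeightOneSpectrum (𝓞 ↥(maximalRealSubfield L)), MeasurableSpace ((cmDatum L 3 H').Local v)]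
    {νG : ∀ v : HeightOneSpectrum (𝓞 ↥(maximalRealSubfield L)), Measure ((cmDatum L 3 H').Local v)} (h1 : Pg.UnramTraceOne νG)
    (S₀ : Finset (HeightOneSpectrum (𝓞 ↥(maximalRealSubfield L)))) : Pg.UnramTraceOneOff S₀ νG :=
  fun v _ hv => h1 v hv

/-- (TF-1)∕S₀ is monotone in `S₀`. [cite: Rogawski1990, §13.3 p. 201 l. 1–4] -/
theorem UnramTraceOneOff.mono {Pg : GlobalPacket 𝔩} [∀ v : HeightOneSpectrum (𝓞 ↥(maximalRealSubfield L)), MeasurableSpace ((cmDatum L 3 H').Local v)]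
    {νG : ∀ v : HeightOneSpectrum (𝓞 ↥(maximalRealSubfield L)), Measure ((cmDatum L 3 H').Local v)}
    {S₀ S₁ : Finset (HeightOneSpectrum (𝓞 ↥(maximalRealSubfield L)))} (h1 : Pg.UnramTraceOneOff S₀ νG) (h : S₀ ⊆ S₁) :
    Pg.UnramTraceOneOff S₁ νG :=
  fun v hv => h1 v fun hv' => hv (h hv')

/-- **Under (TF-1)∕S₀, extra unramified places OUTSIDE a finite `S ⊇ S₀` with `f_v = 1_{K_v}` do not change a finite product of local packet traces.**
[cite: Rogawski1990, §13.3 p. 201 l. 1–4] -/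
theorem prod_eq_prod_of_subset_of_unramTraceOneOff (Pg : GlobalPacket 𝔩)
    [∀ v : HeightOneSpectrum (𝓞 ↥(maximalRealSubfield L)), MeasurableSpace ((cmDatum L 3 H').Local v)]
    (νG : ∀ v : HeightOneSpectrum (𝓞 ↥(maximalRealSubfield L)), Measure ((cmDatum L 3 H').Local v))
    {S₀ : Finset (HeightOneSpectrum (𝓞 ↥(maximalRealSubfield L)))} (h1 : Pg.UnramTraceOneOff S₀ νG)
    (f : ∀ v : HeightOneSpectrum (𝓞 ↥(maximalRealSubfield L)), (cmDatum L 3 H').Local v → ℂ)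
    (S S' : Finset (HeightOneSpectrum (𝓞 ↥(maximalRealSubfield L)))) (hSS' : S ⊆ S') (hram : Pg.ramFinset ⊆ S) (hS₀ : S₀ ⊆ S)
    (hf : ∀ v ∈ S', v ∉ S → f v = (cmLocalIntegralLevel L 3 H' v : Set ((cmDatum L 3 H').Local v)).indicator fun _ => 1) :
    ∏ v ∈ S', (𝔩 v).trPkt (νG v) (Pg.loc v) (f v) = ∏ v ∈ S, (𝔩 v).trPkt (νG v) (Pg.loc v) (f v) := by
  refine (Finset.prod_subset hSS' fun v hvS' hvS => ?_).symm
  rw [hf v hvS' hvS]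
  exact h1 v (fun h => hvS (hS₀ h)) (Pg.unr_of_not_mem_ramFinset fun h => hvS (hram h))

end Summit.HodgeConjecture.HodgeConjecture.Cruxes.H413.F0P3GlobalPacket.GlobalPacket

/-! ## §2 The definitions: `S₀`-presentations, `trOn`, (TF-ind)∕S₀ [p. 201 first display, l. 1–4; §14.2 p. 233] (`H′ := splitForm L 3`) -/

namespace Summit.HodgeConjecture.HodgeConjecture.Cruxes.H413.F0P3SpectralPacket.SpectralPacketG

open Summit.HodgeConjecture.HodgeConjecture.Cruxes.H413.F0P3GlobalPacket

variable {L : Type} [Field L] [NumberField L] [IsCMField L]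
  {𝔩 : ∀ v : HeightOneSpectrum (𝓞 ↥(maximalRealSubfield L)), LocalPacketKit L (splitForm L 3) v} {𝔞 : ArchPacketKit}
  {μ : Measure (adelicGroupData (↥(maximalRealSubfield L)) L (IsCMField.complexConj L) 3 (splitForm L 3)).automorphicQuotient}
  [SMulInvariantMeasure (adelicGroupData (↥(maximalRealSubfield L)) L (IsCMField.complexConj L) 3 (splitForm L 3)).Adelic
    (adelicGroupData (↥(maximalRealSubfield L)) L (IsCMField.complexConj L) 3 (splitForm L 3)).automorphicQuotient μ]

/-- **(d1) `Q.IsTestPresentationOn S₀ F T` — `T` IS A TEST PRESENTATION OF `F` (★ 3d (d1)) WHOSE BAD SET CONTAINS `S₀`**: `T.IsTest`, integral levels, `Π.ramFinset ⊆ T.S`,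
`⇑F = T.eval`, AND `S₀ ⊆ T.S` — print presents `f = ⊗ f_v` with a bad set containing every place where anything is non-standard [§14.2 p. 233]; for the (N) tuple
`S₀ ⊇ M(𝔨.ψ)`. [cite: Rogawski1990, §14.2 p. 233; §13.3 p. 201 l. 1–4] -/
def IsTestPresentationOn (Q : SpectralPacketG 𝔩 𝔞 μ) (S₀ : Finset (HeightOneSpectrum (𝓞 ↥(maximalRealSubfield L)))) (F : TestG L)
    (T : UnitaryGroup.PureTensor L 3 (splitForm L 3)) : Prop :=
  Q.IsTestPresentation F T ∧ S₀ ⊆ T.S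

/-- **(d2) `Q.trOn S₀ νG archTr : TestG L → ℂ` — THE PACKET TRACE `Tr Π(f)` READ ON `S₀`-PRESENTATIONS** (the (N) tuple's `trG Q` since the TUPLE cut): `trTensor` (★ 3d (d2),
`Tr Π_∞(T.arch) · ∏_{v ∈ T.S} Tr Π_v(T.loc v)`) of SOME test presentation of `F` with bad set `⊇ S₀` when one exists (choice; independent of it under (TF-ind)∕S₀,
`trOn_eq_trTensor`, and (TF-ind)∕S₀ is PROVED in §4), `0` otherwise — a value no consumer reads (clause (T) meets only matched `f` of a pinned kit, smooth pure tensors by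
pin (ix′); `trOn_eq_of_isTest`).  Under print's normalisation `ν_v(K_v) = 1` off `S₀` this IS `Tr Π(f)` [p. 201 first display], every omitted factor being `Tr Π_v(1_{K_v}) = 1`.
[cite: Rogawski1990, §13.3 p. 201; §14.2 p. 233; §14.6 (14.6.1) p. 241; §4.3 p. 44] -/
def trOn (Q : SpectralPacketG 𝔩 𝔞 μ) (S₀ : Finset (HeightOneSpectrum (𝓞 ↥(maximalRealSubfield L))))
    [∀ v : HeightOneSpectrum (𝓞 ↥(maximalRealSubfield L)), MeasurableSpace ((cmDatum L 3 (splitForm L 3)).Local v)]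
    (νG : ∀ v : HeightOneSpectrum (𝓞 ↥(maximalRealSubfield L)), Measure ((cmDatum L 3 (splitForm L 3)).Local v))
    (archTr : GKIrrClass (uFormGroup (Fin 2) (Fin 1)) →
      (UnitaryGroup.arch (↥(maximalRealSubfield L)) L (IsCMField.complexConj L) 3 (splitForm L 3) → ℂ) → ℂ)
    (F : TestG L) : ℂ :=
  open scoped Classical in
  if h : ∃ T : UnitaryGroup.PureTensor L 3 (splitForm L 3), Q.IsTestPresentationOn S₀ F T then Q.trTensor νG archTr h.choose else 0

/-- **(d3) (TF-ind)∕S₀ `Q.PresentationIndepOn S₀ νG archTr`** — two test presentations of one `F ∈ C_c(G(𝔸))` WITH BAD SETS `⊇ S₀` have the same `trTensor` (★ 3d (d4) restricted;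
print p. 201 l. 1–4 «the products are well-defined»; PROVED in §4 modulo (TF-1)∕S₀, admissibility and homogeneity of `archTr`). [cite: Rogawski1990, §13.3 p. 201 l. 1–4]
[cite: FlathCorvallis1979, Thm. 3] -/
def PresentationIndepOn (Q : SpectralPacketG 𝔩 𝔞 μ) (S₀ : Finset (HeightOneSpectrum (𝓞 ↥(maximalRealSubfield L))))
    [∀ v : HeightOneSpectrum (𝓞 ↥(maximalRealSubfield L)), MeasurableSpace ((cmDatum L 3 (splitForm L 3)).Local v)]
    (νG : ∀ v : HeightOneSpectrum (𝓞 ↥(maximalRealSubfield L)), Measure ((cmDatum L 3 (splitForm L 3)).Local v))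
    (archTr : GKIrrClass (uFormGroup (Fin 2) (Fin 1)) →
      (UnitaryGroup.arch (↥(maximalRealSubfield L)) L (IsCMField.complexConj L) 3 (splitForm L 3) → ℂ) → ℂ) : Prop :=
  ∀ (F : TestG L) (T T' : UnitaryGroup.PureTensor L 3 (splitForm L 3)),
    Q.IsTestPresentationOn S₀ F T → Q.IsTestPresentationOn S₀ F T' → Q.trTensor νG archTr T = Q.trTensor νG archTr T'

/-! ## §3 Read-backs -/

variable {Q : SpectralPacketG 𝔩 𝔞 μ} {S₀ : Finset (HeightOneSpectrum (𝓞 ↥(maximalRealSubfield L)))}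

/-- Unfolding of (d1). [cite: Rogawski1990, §14.2 p. 233] -/
theorem isTestPresentationOn_iff (F : TestG L) (T : UnitaryGroup.PureTensor L 3 (splitForm L 3)) :
    Q.IsTestPresentationOn S₀ F T ↔ Q.IsTestPresentation F T ∧ S₀ ⊆ T.S :=
  Iff.rfl

/-- An `S₀`-presentation is a test presentation (★ 3d (d1)). [cite: Rogawski1990, §14.2 p. 233] -/
theorem IsTestPresentationOn.isTestPresentation {F : TestG L} {T : UnitaryGroup.PureTensor L 3 (splitForm L 3)}
    (h : Q.IsTestPresentationOn S₀ F T) : Q.IsTestPresentation F T :=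
  h.1

/-- The bad set of an `S₀`-presentation contains `S₀`. [cite: Rogawski1990, §14.2 p. 233] -/
theorem IsTestPresentationOn.subset {F : TestG L} {T : UnitaryGroup.PureTensor L 3 (splitForm L 3)}
    (h : Q.IsTestPresentationOn S₀ F T) : S₀ ⊆ T.S :=
  h.2

/-- An `S₀`-presentation is an `S₁`-presentation for every `S₁ ⊆ S₀`. [cite: Rogawski1990, §14.2 p. 233] -/
theorem IsTestPresentationOn.anti {F : TestG L} {T : UnitaryGroup.PureTensor L 3 (splitForm L 3)}
    (h : Q.IsTestPresentationOn S₀ F T) {S₁ : Finset (HeightOneSpectrum (𝓞 ↥(maximalRealSubfield L)))} (hS : S₁ ⊆ S₀) :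
    Q.IsTestPresentationOn S₁ F T :=
  ⟨h.1, hS.trans h.2⟩

/-- At `S₀ = ∅` an `S₀`-presentation is just a test presentation (★ 3d (d1)). [cite: Rogawski1990, §14.2 p. 233] -/
theorem isTestPresentationOn_empty (F : TestG L) (T : UnitaryGroup.PureTensor L 3 (splitForm L 3)) :
    Q.IsTestPresentationOn ∅ F T ↔ Q.IsTestPresentation F T :=
  ⟨fun h => h.1, fun h => ⟨h, Finset.empty_subset _⟩⟩

/-! ### Every smooth pure tensor has an `S₀`-presentation [§14.2 p. 233] -/

/-- **A smooth pure tensor `⇑F = T.eval` (`T.IsTest`) HAS an `S₀`-presentation** with bad set `T.S ∪ Π.ramFinset ∪ S₀`, the SAME archimedean factor and the SAME local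
factors (★ `PureTensor.ofUnramified`; ★ `eval_ofUnramified_of_isUnramified`, ★ 3d′ `loc_ofUnramified_of_isUnramified`). [cite: Rogawski1990, §14.2 p. 233; §13.3 p. 201 l. 1–4] -/
theorem exists_isTestPresentationOn (Q : SpectralPacketG 𝔩 𝔞 μ) (S₀ : Finset (HeightOneSpectrum (𝓞 ↥(maximalRealSubfield L)))) {F : TestG L}
    {T : UnitaryGroup.PureTensor L 3 (splitForm L 3)} (hT : T.IsTest) (hF : ⇑F = T.eval) :
    ∃ T' : UnitaryGroup.PureTensor L 3 (splitForm L 3), Q.IsTestPresentationOn S₀ F T' ∧ T.S ⊆ T'.S ∧ T'.arch = T.arch ∧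
      ∀ v : HeightOneSpectrum (𝓞 ↥(maximalRealSubfield L)), T'.loc v = T.loc v := by
  classical
  refine ⟨UnitaryGroup.PureTensor.ofUnramified L 3 (splitForm L 3) (T.S ∪ Q.fin.ramFinset ∪ S₀) T.loc T.arch,
    ⟨⟨T.isTest_ofUnramified_of_isTest hT _, fun _ => rfl, ?_, ?_⟩, ?_⟩, ?_, rfl,
    loc_ofUnramified_of_isUnramified T hT.isUnramified _ (Finset.subset_union_left.trans Finset.subset_union_left)⟩
  · rw [UnitaryGroup.PureTensor.ofUnramified_S]
    exact Finset.subset_union_right.trans Finset.subset_union_left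
  · rw [hF, T.eval_ofUnramified_of_isUnramified hT.isUnramified _ (Finset.subset_union_left.trans Finset.subset_union_left)]
  · rw [UnitaryGroup.PureTensor.ofUnramified_S]
    exact Finset.subset_union_right
  · rw [UnitaryGroup.PureTensor.ofUnramified_S]
    exact Finset.subset_union_left.trans Finset.subset_union_left

/-- The junk clause of `trOn` never fires at a smooth pure tensor: some `S₀`-presentation exists. [cite: Rogawski1990, §14.2 p. 233] -/
theorem exists_isTestPresentationOn_of_isTest (Q : SpectralPacketG 𝔩 𝔞 μ) (S₀ : Finset (HeightOneSpectrum (𝓞 ↥(maximalRealSubfield L)))) {F : TestG L}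
    {T : UnitaryGroup.PureTensor L 3 (splitForm L 3)} (hT : T.IsTest) (hF : ⇑F = T.eval) :
    ∃ T' : UnitaryGroup.PureTensor L 3 (splitForm L 3), Q.IsTestPresentationOn S₀ F T' :=
  (Q.exists_isTestPresentationOn S₀ hT hF).imp fun _ h => h.1

/-! ### The functional -/

variable [∀ v : HeightOneSpectrum (𝓞 ↥(maximalRealSubfield L)), MeasurableSpace ((cmDatum L 3 (splitForm L 3)).Local v)]
  {νG : ∀ v : HeightOneSpectrum (𝓞 ↥(maximalRealSubfield L)), Measure ((cmDatum L 3 (splitForm L 3)).Local v)}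
  {archTr : GKIrrClass (uFormGroup (Fin 2) (Fin 1)) →
    (UnitaryGroup.arch (↥(maximalRealSubfield L)) L (IsCMField.complexConj L) 3 (splitForm L 3) → ℂ) → ℂ}

/-- Unfolding of (d3). [cite: Rogawski1990, §13.3 p. 201 l. 1–4] -/
theorem presentationIndepOn_iff :
    Q.PresentationIndepOn S₀ νG archTr ↔ ∀ (F : TestG L) (T T' : UnitaryGroup.PureTensor L 3 (splitForm L 3)),
      Q.IsTestPresentationOn S₀ F T → Q.IsTestPresentationOn S₀ F T' → Q.trTensor νG archTr T = Q.trTensor νG archTr T' :=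
  Iff.rfl

/-- The absolute law (TF-ind) (★ 3d (d4)) implies (TF-ind)∕S₀. [cite: Rogawski1990, §13.3 p. 201 l. 1–4] -/
theorem PresentationIndep.on (hind : Q.PresentationIndep νG archTr) (S₀ : Finset (HeightOneSpectrum (𝓞 ↥(maximalRealSubfield L)))) :
    Q.PresentationIndepOn S₀ νG archTr :=
  fun F T T' hT hT' => hind F T T' hT.1 hT'.1

/-- **At `S₀ = ∅`, `trOn` IS ★ 3d's `tr`** (the ED. 26–28 (T)-slot): `Q.trOn ∅ νG archTr = Q.tr νG archTr` (REF1 (g10) m27 read-back). [cite: Rogawski1990, §13.3 p. 201] -/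
theorem trOn_empty (Q : SpectralPacketG 𝔩 𝔞 μ) (νG : ∀ v : HeightOneSpectrum (𝓞 ↥(maximalRealSubfield L)), Measure ((cmDatum L 3 (splitForm L 3)).Local v))
    (archTr : GKIrrClass (uFormGroup (Fin 2) (Fin 1)) →
      (UnitaryGroup.arch (↥(maximalRealSubfield L)) L (IsCMField.complexConj L) 3 (splitForm L 3) → ℂ) → ℂ) :
    Q.trOn ∅ νG archTr = Q.tr νG archTr := by
  have h : Q.IsTestPresentationOn ∅ = Q.IsTestPresentation :=
    funext fun F => funext fun T => propext (isTestPresentationOn_empty F T)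
  funext F
  unfold trOn
  rw [h]
  rfl

/-- **The junk clause**: off the smooth pure tensors `S₀`-presented at the integral levels, `trOn := 0`. [cite: Rogawski1990, §13.3 p. 201] -/
theorem trOn_of_not {F : TestG L} (h : ¬ ∃ T : UnitaryGroup.PureTensor L 3 (splitForm L 3), Q.IsTestPresentationOn S₀ F T) :
    Q.trOn S₀ νG archTr F = 0 := by
  rw [trOn, dif_neg h]

/-- **Under (TF-ind)∕S₀, `trOn S₀` is the product of ANY `S₀`-presentation of `F`.** [cite: Rogawski1990, §13.3 p. 201 l. 1–4] -/
theorem trOn_eq_trTensor (hind : Q.PresentationIndepOn S₀ νG archTr) {F : TestG L} {T : UnitaryGroup.PureTensor L 3 (splitForm L 3)}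
    (hT : Q.IsTestPresentationOn S₀ F T) : Q.trOn S₀ νG archTr F = Q.trTensor νG archTr T := by
  have h : ∃ T' : UnitaryGroup.PureTensor L 3 (splitForm L 3), Q.IsTestPresentationOn S₀ F T' := ⟨T, hT⟩
  rw [trOn, dif_pos h]
  exact hind F _ _ h.choose_spec hT

/-- **Under (TF-1)∕S₀, `trTensor` of an `S₀`-presentation is the product over ANY finite `S′ ⊇ T.S`** (the extra places lie outside `T.S ⊇ S₀ ∪ Π.ramFinset`, where the factor is
`Tr Π_v(1_{K_v}) = 1`). [cite: Rogawski1990, §13.3 p. 201 l. 1–4] -/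
theorem trTensor_eq_prod_of_subset_of_off (h1 : Q.fin.UnramTraceOneOff S₀ νG) {F : TestG L}
    {T : UnitaryGroup.PureTensor L 3 (splitForm L 3)} (hT : Q.IsTestPresentationOn S₀ F T)
    (S' : Finset (HeightOneSpectrum (𝓞 ↥(maximalRealSubfield L)))) (hS : T.S ⊆ S') :
    Q.trTensor νG archTr T = 𝔞.trPktInf archTr Q.inf T.arch * ∏ v ∈ S', (𝔩 v).trPkt (νG v) (Q.fin.loc v) (T.loc v) := by
  rw [trTensor_eq, Q.fin.prod_eq_prod_of_subset_of_unramTraceOneOff νG h1 T.loc T.S S' hS hT.1.2.2.1 hT.2 fun v _ hv => by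
    rw [T.loc_eq_indicator v hv, hT.1.2.1 v]]

/-- **CONSUMER FORM — `trOn S₀` AT A SMOOTH PURE TENSOR IS THE PRODUCT over any finite `S′ ⊇ T.S ∪ Π.ramFinset ∪ S₀`** (under (TF-ind)∕S₀ and (TF-1)∕S₀; ★ 3d `tr_eq_of_isTest` for
`trOn`, (TF-1) now used only at places `v ∉ S₀`): with pin (ix′) `IsPinned.transfer_tensors` this is what clause (T)∕(P1) read at every matched `f`. [cite: Rogawski1990, §13.3 p. 201; §14.2 p. 233; §14.6 (14.6.1) p. 241] -/
theorem trOn_eq_of_isTest (hind : Q.PresentationIndepOn S₀ νG archTr) (h1 : Q.fin.UnramTraceOneOff S₀ νG) {F : TestG L}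
    {T : UnitaryGroup.PureTensor L 3 (splitForm L 3)} (hT : T.IsTest) (hF : ⇑F = T.eval)
    (S' : Finset (HeightOneSpectrum (𝓞 ↥(maximalRealSubfield L)))) (hS : T.S ⊆ S') (hram : Q.fin.ramFinset ⊆ S') (hS₀ : S₀ ⊆ S') :
    Q.trOn S₀ νG archTr F = 𝔞.trPktInf archTr Q.inf T.arch * ∏ v ∈ S', (𝔩 v).trPkt (νG v) (Q.fin.loc v) (T.loc v) := by
  classical
  obtain ⟨T', hT', hTS, harch, hloc⟩ := Q.exists_isTestPresentationOn S₀ hT hF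
  -- `T′.S ⊆ S′` is not known, so pass through `T′.S ∪ S′` twice
  have hb : ∀ v ∈ T'.S ∪ S', v ∉ S' →
      T.loc v = (cmLocalIntegralLevel L 3 (splitForm L 3) v : Set ((cmDatum L 3 (splitForm L 3)).Local v)).indicator fun _ => 1 := by
    intro v _ hv
    rw [T.loc_eq_indicator v (fun h => hv (hS h)), hT.isUnramified.K_eq (fun h => hv (hS h))]
  rw [Q.trOn_eq_trTensor hind hT', Q.trTensor_eq_prod_of_subset_of_off h1 hT' (T'.S ∪ S') Finset.subset_union_left, harch,
    ← Q.fin.prod_eq_prod_of_subset_of_unramTraceOneOff νG h1 T.loc S' (T'.S ∪ S') Finset.subset_union_right hram hS₀ hb]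
  exact congrArg _ (Finset.prod_congr rfl fun v _ => by rw [hloc v])

/-! ## §4 (TF-ind)∕S₀ discharged [p. 201 l. 1–4; FlathCorvallis1979 Thm. 3] -/

variable [∀ v : HeightOneSpectrum (𝓞 ↥(maximalRealSubfield L)), BorelSpace ((cmDatum L 3 (splitForm L 3)).Local v)]
  [∀ v, (νG v).IsMulLeftInvariant] [∀ v, IsFiniteMeasureOnCompacts (νG v)]

/-- **(TF-ind)∕S₀ DISCHARGED — `Q.PresentationIndepOn S₀ νG archTr`**, modulo (TF-1)∕S₀ `UnramTraceOneOff`, admissibility of the members of every `Π_v`, and homogeneity of the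
archimedean distribution characters `archTr` (★ 3d′ `presentationIndep_of_admissible`, line for line, the common bad set `T.S ∪ T′.S` now containing `S₀`).
[cite: Rogawski1990, §13.3 p. 201 l. 1–4] [cite: FlathCorvallis1979, Thm. 3] [cite: BorelJacquet1979, §4.1] -/
theorem presentationIndepOn_of_admissible (Q : SpectralPacketG 𝔩 𝔞 μ) (S₀ : Finset (HeightOneSpectrum (𝓞 ↥(maximalRealSubfield L))))
    (h1 : Q.fin.UnramTraceOneOff S₀ νG)
    (hadm : ∀ (v : HeightOneSpectrum (𝓞 ↥(maximalRealSubfield L))), ∀ π ∈ (𝔩 v).mem (Q.fin.loc v), π.IsAdmissible)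
    (harch : ∀ (c : GKIrrClass (uFormGroup (Fin 2) (Fin 1))) (k : ℂ)
      (f : UnitaryGroup.arch (↥(maximalRealSubfield L)) L (IsCMField.complexConj L) 3 (splitForm L 3) → ℂ), archTr c (k • f) = k * archTr c f) :
    Q.PresentationIndepOn S₀ νG archTr := by
  classical
  intro F T T' hT hT'
  -- common bad set and the re-presentations there
  set S'' := T.S ∪ T'.S with hS''
  set T₁ := UnitaryGroup.PureTensor.ofUnramified L 3 (splitForm L 3) S'' T.loc T.arch with hT₁
  set T₁' := UnitaryGroup.PureTensor.ofUnramified L 3 (splitForm L 3) S'' T'.loc T'.arch with hT₁'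
  have hl : ∀ v, T₁.loc v = T.loc v := loc_ofUnramified_of_isUnramified T hT.1.1.isUnramified S'' Finset.subset_union_left
  have hl' : ∀ v, T₁'.loc v = T'.loc v := loc_ofUnramified_of_isUnramified T' hT'.1.1.isUnramified S'' Finset.subset_union_right
  have he : T₁.eval = T₁'.eval := by
    rw [hT₁, hT₁', T.eval_ofUnramified_of_isUnramified hT.1.1.isUnramified S'' Finset.subset_union_left,
      T'.eval_ofUnramified_of_isUnramified hT'.1.1.isUnramified S'' Finset.subset_union_right, ← hT.1.2.2.2, ← hT'.1.2.2.2]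
  -- the box identity at `S''`
  have hbox : ∀ (xinf : UnitaryGroup.arch (↥(maximalRealSubfield L)) L (IsCMField.complexConj L) 3 (splitForm L 3))
      (x : ∀ v : HeightOneSpectrum (𝓞 ↥(maximalRealSubfield L)), (cmDatum L 3 (splitForm L 3)).Local v),
      T.arch xinf * ∏ v ∈ S'', T.loc v (x v) = T'.arch xinf * ∏ v ∈ S'', T'.loc v (x v) := by
    intro xinf x
    have h := arch_mul_prod_loc_eq_of_eval_eq T₁ T₁' (fun v _ => rfl) (fun v _ => rfl) rfl he xinf x
    have e1 : ∏ v ∈ S'', T₁.loc v (x v) = ∏ v ∈ S'', T.loc v (x v) := Finset.prod_congr rfl fun v _ => by rw [hl v]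
    have e2 : ∏ v ∈ S'', T₁'.loc v (x v) = ∏ v ∈ S'', T'.loc v (x v) := Finset.prod_congr rfl fun v _ => by rw [hl' v]
    have ha : T₁.arch = T.arch := rfl
    have ha' : T₁'.arch = T'.arch := rfl
    have hS₁ : T₁.S = S'' := rfl
    rw [hS₁, e1, e2, ha, ha'] at h
    exact h
  -- both values as products over `S''` ((TF-1) only at `v ∉ T.S ⊇ S₀`, resp. `v ∉ T′.S ⊇ S₀`), then ★ 3d′ §1
  rw [trTensor_eq_prod_of_subset_of_off h1 hT S'' Finset.subset_union_left, trTensor_eq_prod_of_subset_of_off h1 hT' S'' Finset.subset_union_right]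
  exact mul_prod_eq_of_forall_mul_prod_eq (X₀ := UnitaryGroup.arch (↥(maximalRealSubfield L)) L (IsCMField.complexConj L) 3 (splitForm L 3))
    (X := fun v : HeightOneSpectrum (𝓞 ↥(maximalRealSubfield L)) => (cmDatum L 3 (splitForm L 3)).Local v)
    (𝔞.trPktInf archTr Q.inf) (fun v => (𝔩 v).trPkt (νG v) (Q.fin.loc v))
    (trPktInf_const_smul 𝔞 archTr harch Q.inf) (fun v k f => trPkt_const_smul (𝔩 v) (νG v) (Q.fin.loc v) (hadm v) k f)
    T.loc T'.loc S'' T.arch T'.arch hbox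

/-- **Hence, under the same three hypotheses, `trOn S₀ F` IS the product of ANY `S₀`-presentation.** [cite: Rogawski1990, §13.3 p. 201 l. 1–4] -/
theorem trOn_eq_trTensor_of_admissible (Q : SpectralPacketG 𝔩 𝔞 μ) (S₀ : Finset (HeightOneSpectrum (𝓞 ↥(maximalRealSubfield L))))
    (h1 : Q.fin.UnramTraceOneOff S₀ νG)
    (hadm : ∀ (v : HeightOneSpectrum (𝓞 ↥(maximalRealSubfield L))), ∀ π ∈ (𝔩 v).mem (Q.fin.loc v), π.IsAdmissible)
    (harch : ∀ (c : GKIrrClass (uFormGroup (Fin 2) (Fin 1))) (k : ℂ)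
      (f : UnitaryGroup.arch (↥(maximalRealSubfield L)) L (IsCMField.complexConj L) 3 (splitForm L 3) → ℂ), archTr c (k • f) = k * archTr c f)
    {F : TestG L} {T : UnitaryGroup.PureTensor L 3 (splitForm L 3)} (hT : Q.IsTestPresentationOn S₀ F T) :
    Q.trOn S₀ νG archTr F = Q.trTensor νG archTr T :=
  Q.trOn_eq_trTensor (Q.presentationIndepOn_of_admissible S₀ h1 hadm harch) hT

/-- **… and the consumer form with (TF-ind)∕S₀ discharged**: `trOn S₀ F = Tr Π_∞(T.arch) · ∏_{v ∈ S′} Tr Π_v(T.loc v)` for a smooth pure tensor `⇑F = T.eval` and any finite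
`S′ ⊇ T.S ∪ Π.ramFinset ∪ S₀`. [cite: Rogawski1990, §13.3 p. 201; §14.2 p. 233; §14.6 (14.6.1) p. 241] -/
theorem trOn_eq_of_isTest_of_admissible (Q : SpectralPacketG 𝔩 𝔞 μ) (S₀ : Finset (HeightOneSpectrum (𝓞 ↥(maximalRealSubfield L))))
    (h1 : Q.fin.UnramTraceOneOff S₀ νG)
    (hadm : ∀ (v : HeightOneSpectrum (𝓞 ↥(maximalRealSubfield L))), ∀ π ∈ (𝔩 v).mem (Q.fin.loc v), π.IsAdmissible)
    (harch : ∀ (c : GKIrrClass (uFormGroup (Fin 2) (Fin 1))) (k : ℂ)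
      (f : UnitaryGroup.arch (↥(maximalRealSubfield L)) L (IsCMField.complexConj L) 3 (splitForm L 3) → ℂ), archTr c (k • f) = k * archTr c f)
    {F : TestG L} {T : UnitaryGroup.PureTensor L 3 (splitForm L 3)} (hT : T.IsTest) (hF : ⇑F = T.eval)
    (S' : Finset (HeightOneSpectrum (𝓞 ↥(maximalRealSubfield L)))) (hS : T.S ⊆ S') (hram : Q.fin.ramFinset ⊆ S') (hS₀ : S₀ ⊆ S') :
    Q.trOn S₀ νG archTr F = 𝔞.trPktInf archTr Q.inf T.arch * ∏ v ∈ S', (𝔩 v).trPkt (νG v) (Q.fin.loc v) (T.loc v) :=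
  Q.trOn_eq_of_isTest (Q.presentationIndepOn_of_admissible S₀ h1 hadm harch) h1 hT hF S' hS hram hS₀

end Summit.HodgeConjecture.HodgeConjecture.Cruxes.H413.F0P3SpectralPacket.SpectralPacketG

end
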